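import Summits.CriticalPhenomena.SAWScalingLimit.Theorems.SAWDefectDecoherenceMassRatioRenewalDefs

/-!
# Crux `SAWDefectDecoherence.MassRatio` (stmt-CriticalPhenomena-8550), line `renewal-averaging-at-b` — stub `stub_renewalCut`

**The renewal cut** (Kesten's bridge decomposition in its one-cut form): for a finite vertex set
`Λ` containing the lattice rectangle `Rect m (m+2t) (p-W) (p+W)` above the door `door m p` whose
outer endpoint `bv (m-1) p` is off `Λ`, any root mid-edge `a` and `t ≥ 1`,
`cutSum Λ a m p t W = Σ_{h=t}^{2t} Σ_{|j| ≤ W} Z_{Λ∖box_h}(a → top_{h,j}) · κ_t(h,j) ≤ Z_Λ(a → door)`.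

Proof: one injection. For `γ : a → top_{h,j}` inside `Λ ∖ box_h` and a box walk
`β : top_{h,j} → door` inside `box_h` with no renewal level in `[t, h)`, the concatenated vertex
list `γ.verts ++ β.verts` is a self-avoiding walk `a → door` of `Λ` (`RenewalCut.glue`: the
junction `last γ = bv (m+h) (p+j) ∼ head β = bv (m+h-1) (p+j)` is the edge `top_{h,j}` itself),
of weight `x_c^{|γ|} x_c^{|β|}`; and `(h, j, γ, β) ↦ γ.verts ++ β.verts` is injective
(`RenewalCut.glue_inj`: if `γ ++ β = γ' ++ β'` with `h' ≤ h` then `β = c ++ β'`; `c ≠ []` would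
make `m + h'` a renewal level of `β` in `[t, h)`, and `c = []` forces `(h, j) = (h', j')` by the
heads). Summing `x_c^{ℓ}` over the image gives the bound (`Negative.norm_Z_eq_sum`).
Vocabulary: `Theorems/SAWDefectDecoherenceMassRatioRenewalDefs.lean`. Sources: H. Kesten,
J. Math. Phys. 4 (1963); N. Madras, G. Slade, *The Self-Avoiding Walk* (1993) §4.2.
-/

noncomputable section

namespace Summit.CriticalPhenomena.SAWScalingLimit.Theorems.MassRatio.Renewal

open Literature.Probability.LatticeModels Literature.Probability.RandomPlanarGeometry
open Literature.Probability.RandomPlanarGeometry.SAW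
open Summit.CriticalPhenomena.SAWScalingLimit.Theorems.MassRatio.Negative

namespace RenewalCut
/-! ### Helper lemmas for `stub_renewalCut` -/

variable {Λ : Finset HexVertex} {a : Sym2 HexVertex} {m p : ℤ} {t W h : ℕ} {j : ℤ}

/-! #### Lattice facts about boxes, tops and the door -/

/-- Membership in the box. [folklore] -/
theorem mem_box {v : HexVertex} :
    v ∈ box m p h W ↔ m ≤ row v ∧ row v ≤ m + h - 1 ∧ p - W ≤ pos v ∧ pos v ≤ p + W := mem_Rect

/-- The outer endpoint of a top edge is above the box. [folklore] -/
theorem top_outer_not_mem_box (m p : ℤ) (h W : ℕ) (j : ℤ) : bv (m + h) (p + j) ∉ box m p h W := by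
  rw [mem_box, row_bv]; omega

/-- The inner endpoint of a top edge lies in the box (`|j| ≤ W`, `h ≥ 1`). [folklore] -/
theorem top_inner_mem_box (hh : 1 ≤ h) (hj : -(W : ℤ) ≤ j ∧ j ≤ W) :
    bv (m + h - 1) (p + j) ∈ box m p h W := by
  rw [mem_box, row_bv, pos_bv]; omega

/-- The inner endpoint of the door lies in the box (`h ≥ 1`). [folklore] -/
theorem door_inner_mem_box (hh : 1 ≤ h) : bv m p ∈ box m p h W := by
  rw [mem_box, row_bv, pos_bv]; omega

/-- Boxes are nested in the height. [folklore] -/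
theorem box_mono {h' : ℕ} (hh : h' ≤ h) : box m p h' W ⊆ box m p h W := by
  intro v hv
  rw [mem_box] at hv ⊢
  omega

/-- Boxes of height `≤ 2t` lie in the rectangle of the statement. [folklore] -/
theorem box_subset_Rect (hh : h ≤ 2 * t) : box m p h W ⊆ Rect m (m + 2 * t) (p - W) (p + W) := by
  intro v hv
  rw [mem_box] at hv
  rw [mem_Rect]
  omega

/-- `top ≠ door` for `h ≥ 1`. [folklore] -/
theorem top_ne_door (hh : 1 ≤ h) : top m p h j ≠ door m p := by
  intro heq
  have hmem : bv (m + h) (p + j) ∈ door m p := by rw [← heq, top]; exact Sym2.mem_mk_left _ _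
  rw [door, Sym2.mem_iff] at hmem
  rcases hmem with h1 | h1
  · have := (bv_inj h1).1; omega
  · have := (bv_inj h1).1; omega

/-! #### Edge lists of concatenated vertex lists -/

/-- The consecutive pairs of `l₁ ++ u :: w :: l₂`: those of `l₁ ++ [u]`, the junction pair
`s(u, w)`, and those of `w :: l₂`. [folklore] -/
theorem edges_append_cons_cons (u w : HexVertex) (l₂ : List HexVertex) : ∀ l₁ : List HexVertex,
    List.zipWith (fun x y => s(x, y)) (l₁ ++ u :: w :: l₂) (l₁ ++ u :: w :: l₂).tail =
      List.zipWith (fun x y => s(x, y)) (l₁ ++ [u]) (l₁ ++ [u]).tail ++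
        s(u, w) :: List.zipWith (fun x y => s(x, y)) (w :: l₂) (w :: l₂).tail
  | [] => rfl
  | [_] => rfl
  | x :: y :: l₁ => by
    have ih := edges_append_cons_cons u w l₂ (y :: l₁)
    change s(x, y) :: List.zipWith (fun x y => s(x, y)) (y :: l₁ ++ u :: w :: l₂)
        (y :: l₁ ++ u :: w :: l₂).tail =
      s(x, y) :: (List.zipWith (fun x y => s(x, y)) (y :: l₁ ++ [u]) (y :: l₁ ++ [u]).tail ++
        s(u, w) :: List.zipWith (fun x y => s(x, y)) (w :: l₂) (w :: l₂).tail)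
    rw [ih]

/-! #### Endpoints of the two pieces -/

/-- A box walk `top → door` is nonempty (`h ≥ 1`). [folklore] -/
theorem verts_ne_nil (hh : 1 ≤ h) (β : HexMidEdgeSAW (box m p h W) (top m p h j) (door m p)) :
    β.verts ≠ [] :=
  fun h0 => top_ne_door hh (β.eq_of_nil h0)

/-- A box walk `top_{h,j} → door` starts at the inner endpoint `bv (m+h-1) (p+j)` of the top edge.
[folklore] -/
theorem head?_eq (hh : 1 ≤ h) (β : HexMidEdgeSAW (box m p h W) (top m p h j) (door m p)) :
    β.verts.head? = some (bv (m + h - 1) (p + j)) := by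
  have hne := verts_ne_nil hh β
  rw [List.head?_eq_some_head hne, Option.some_inj]
  have hmem : β.verts.head hne ∈ s(bv (m + h) (p + j), bv (m + h - 1) (p + j)) :=
    β.head_mem _ (List.head?_eq_some_head hne)
  have hbox := β.subset _ (List.head_mem hne)
  rcases Sym2.mem_iff.1 hmem with h1 | h1
  · rw [h1] at hbox
    exact absurd hbox (top_outer_not_mem_box m p h W j)
  · exact h1

/-- A nonempty walk of the shaved domain `Λ ∖ box_h` ending on `top_{h,j}` ends at the outer
endpoint `bv (m+h) (p+j)`. [folklore] -/
theorem getLast?_eq (hh : 1 ≤ h) (hj : -(W : ℤ) ≤ j ∧ j ≤ W)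
    (γ : HexMidEdgeSAW (Λ \ box m p h W) a (top m p h j)) (hne : γ.verts ≠ []) :
    γ.verts.getLast? = some (bv (m + h) (p + j)) := by
  rw [List.getLast?_eq_some_getLast hne, Option.some_inj]
  have hmem : γ.verts.getLast hne ∈ s(bv (m + h) (p + j), bv (m + h - 1) (p + j)) :=
    γ.getLast_mem _ (List.getLast?_eq_some_getLast hne)
  have hout := (Finset.mem_sdiff.1 (γ.subset _ (List.getLast_mem hne))).2
  rcases Sym2.mem_iff.1 hmem with h1 | h1
  · exact h1
  · rw [h1] at hout
    exact absurd (top_inner_mem_box hh hj) hout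

/-! #### Gluing the two pieces -/

/-- **Gluing.** A walk `γ : a → top_{h,j}` of the shaved domain `Λ ∖ box_h` followed by a box walk
`β : top_{h,j} → door` is a self-avoiding walk `a → door` of `Λ` with vertex list
`γ.verts ++ β.verts` (`box_h ⊆ Λ`, `|j| ≤ W`, `h ≥ 1`, and the outer endpoint of the door off `Λ`,
which forces `a ≠ door`). [folklore] -/
theorem glue (hh : 1 ≤ h) (hj : -(W : ℤ) ≤ j ∧ j ≤ W) (hbox : box m p h W ⊆ Λ)
    (hout : bv (m - 1) p ∉ Λ) (γ : HexMidEdgeSAW (Λ \ box m p h W) a (top m p h j))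
    (β : HexMidEdgeSAW (box m p h W) (top m p h j) (door m p)) :
    ∃ ω : HexMidEdgeSAW Λ a (door m p), ω.verts = γ.verts ++ β.verts := by
  have hβne := verts_ne_nil hh β
  by_cases hγ : γ.verts = []
  · -- the first piece is trivial: `a = top`, and the glued walk is `β` read in `Λ`
    have ha : a = top m p h j := γ.eq_of_nil hγ
    subst ha
    obtain ⟨he, v, hv, hvΛ⟩ := β.fst_mem
    exact ⟨⟨β.verts, fun v hv => hbox (β.subset v hv), β.nodup, β.isChain, β.head_mem,
      β.getLast_mem, β.eq_of_nil, β.edges_nodup, he, v, hv, hbox hvΛ⟩,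
      by rw [hγ, List.nil_append]⟩
  -- `γ.verts = l₁ ++ [u]` with `u` the outer endpoint of `top`, `β.verts = w :: l₂` with `w` the
  -- inner one, so that the junction pair `s(u, w)` is `top` itself
  obtain ⟨w, l₂, hβeq⟩ := List.exists_cons_of_ne_nil hβne
  have hw : w = bv (m + h - 1) (p + j) := by
    have := head?_eq hh β
    rw [hβeq, List.head?_cons, Option.some_inj] at this
    exact this
  obtain ⟨l₁, u, hγeq⟩ := (List.eq_nil_or_concat γ.verts).resolve_left hγ
  rw [List.concat_eq_append] at hγeq
  have hu : u = bv (m + h) (p + j) := by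
    have := getLast?_eq hh hj γ hγ
    rw [hγeq, List.getLast?_concat, Option.some_inj] at this
    exact this
  have htop : top m p h j = s(u, w) := by rw [hu, hw]; rfl
  have hadj : hexGraph.Adj u w := by
    rw [hu, hw]
    exact (SimpleGraph.mem_edgeSet _).1 β.fst_mem.1
  have hγΛ : ∀ v ∈ γ.verts, v ∈ Λ := fun v hv => (Finset.mem_sdiff.1 (γ.subset v hv)).1
  have hγout : ∀ v ∈ γ.verts, v ∉ box m p h W := fun v hv =>
    (Finset.mem_sdiff.1 (γ.subset v hv)).2
  refine ⟨⟨γ.verts ++ β.verts, ?_, ?_, ?_, ?_, ?_, ?_, ?_, ?_⟩, rfl⟩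
  · -- subset
    intro v hv
    rcases List.mem_append.1 hv with hv | hv
    · exact hγΛ v hv
    · exact hbox (β.subset v hv)
  · -- nodup: the two supports are disjoint
    exact List.nodup_append.2
      ⟨γ.nodup, β.nodup, fun x hx y hy hxy => hγout x hx (hxy ▸ β.subset y hy)⟩
  · -- chain: the junction is the edge `top`
    refine List.isChain_append.2 ⟨γ.isChain, β.isChain, fun x hx y hy => ?_⟩
    rw [hγeq, List.getLast?_concat, Option.mem_def, Option.some_inj] at hx
    rw [hβeq, List.head?_cons, Option.mem_def, Option.some_inj] at hy
    subst hx hy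
    exact hadj
  · -- starts on `a`
    intro v hv
    rw [List.head?_append, List.head?_eq_some_head hγ, Option.some_or] at hv
    exact γ.head_mem v (by rw [List.head?_eq_some_head hγ]; exact hv)
  · -- ends on the door
    intro v hv
    rw [List.getLast?_append, List.getLast?_eq_some_getLast hβne, Option.some_or] at hv
    exact β.getLast_mem v (by rw [List.getLast?_eq_some_getLast hβne]; exact hv)
  · -- nonempty
    intro h0
    exact (hβne (List.append_eq_nil_iff.1 h0).2).elim
  · -- no edge twice
    intro _
    have hE := γ.edges_nodup hγ
    rw [hγeq, htop] at hE
    have hF := β.edges_nodup hβne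
    rw [hβeq, htop] at hF
    rw [hγeq, hβeq, List.append_assoc, List.singleton_append, edges_append_cons_cons]
    have key : ((a :: List.zipWith (fun x y => s(x, y)) (l₁ ++ [u]) (l₁ ++ [u]).tail) ++
        (s(u, w) :: List.zipWith (fun x y => s(x, y)) (w :: l₂) (w :: l₂).tail ++
          [door m p])).Nodup := by
      refine List.nodup_append.2 ⟨(List.nodup_append.1 hE).1, hF, ?_⟩
      intro e he e' he' hee
      subst hee
      -- every pair on the `γ` side has a vertex on `γ`
      obtain ⟨c, hce, hcγ⟩ : ∃ c ∈ e, c ∈ γ.verts := by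
        rcases List.mem_cons.1 he with hea | he
        · rw [hea]
          exact ⟨_, γ.head_mem _ (List.head?_eq_some_head hγ), List.head_mem hγ⟩
        · refine ⟨_, Sym2.out_fst_mem e, ?_⟩
          rw [hγeq]
          exact forall_mem_of_mem_edges _ _ he _ (Sym2.out_fst_mem e)
      rcases List.mem_append.1 he' with he' | he'
      · rcases List.mem_cons.1 he' with rfl | he'
        · -- the junction pair `top`: excluded by `γ.edges_nodup`
          exact (List.nodup_append.1 hE).2.2 _ he _ (List.mem_singleton_self _) rfl
        · -- a pair of `β`: both its vertices are in the box, `c` is not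
          have hcβ : c ∈ β.verts := by
            rw [hβeq]
            exact forall_mem_of_mem_edges _ _ he' c hce
          exact hγout c hcγ (β.subset c hcβ)
      · -- the door: its endpoints are off `Λ` resp. in the box, `c` is neither
        rw [List.mem_singleton] at he'
        subst he'
        rcases Sym2.mem_iff.1 hce with rfl | rfl
        · exact hout (hγΛ _ hcγ)
        · exact hγout _ hcγ (door_inner_mem_box hh)
    simpa only [List.cons_append, List.append_assoc] using key
  · -- `a` is a mid-edge of `Λ`
    obtain ⟨he, v, hv, hvΛ⟩ := γ.fst_mem
    exact ⟨he, v, hv, (Finset.mem_sdiff.1 hvΛ).1⟩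

/-! #### Injectivity of the gluing -/

/-- Two splittings `γ ++ β = γ' ++ β'` of one list with `γ` off a set containing `β'`:
`γ' = γ ++ c` and `β = c ++ β'` for some `c`. [folklore] -/
theorem exists_append_of_append_eq {B : Finset HexVertex} {γ β γ' β' : List HexVertex}
    (hγ : ∀ v ∈ γ, v ∉ B) (hβ' : ∀ v ∈ β', v ∈ B) (heq : γ ++ β = γ' ++ β') :
    ∃ c, γ' = γ ++ c ∧ β = c ++ β' := by
  rcases List.append_eq_append_iff.1 heq with ⟨c, h1, h2⟩ | ⟨c, h1, h2⟩
  · exact ⟨c, h1, h2⟩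
  · rcases c with _ | ⟨v, c⟩
    · rw [List.append_nil] at h1
      rw [List.nil_append] at h2
      exact ⟨[], by rw [h1, List.append_nil], by rw [h2, List.nil_append]⟩
    · have hvγ : v ∈ γ := by rw [h1]; simp
      have hvβ' : v ∈ β' := by rw [h2]; simp
      exact (hγ v hvγ (hβ' v hvβ')).elim

/-- **Injectivity of the gluing** on box walks without renewal levels in `[t, h)`: if
`γ ++ β.verts = γ' ++ β'.verts` for a box walk `β` of height `h` with `NoSplit m t h β.verts`, a box
walk `β'` of height `h' ∈ [t, h]`, and lists `γ`, `γ'` off the respective boxes, then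
`(h, j) = (h', j')`, `γ = γ'` and `β = β'`. (Write `β = c ++ β'`; a nonempty `c` lies in
`box_h ∖ box_{h'}`, i.e. at rows `≥ m + h'`, while `β' ⊆ box_{h'}` lies below: `m + h'` would be a
renewal level of `β` in `[t, h)`; so `c = []`, and the heads `bv (m+h-1) (p+j) = bv (m+h'-1) (p+j')`
agree.) [folklore] -/
theorem glue_inj {h' : ℕ} {j' : ℤ} (hth : t ≤ h') (hh : h' ≤ h) (h1 : 1 ≤ h')
    (β : HexMidEdgeSAW (box m p h W) (top m p h j) (door m p))
    (β' : HexMidEdgeSAW (box m p h' W) (top m p h' j') (door m p))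
    (hns : NoSplit m t h β.verts) {γ γ' : List HexVertex}
    (hγ : ∀ v ∈ γ, v ∉ box m p h W) (hγ' : ∀ v ∈ γ', v ∉ box m p h' W)
    (heq : γ ++ β.verts = γ' ++ β'.verts) :
    h = h' ∧ j = j' ∧ γ = γ' ∧ β.verts = β'.verts := by
  obtain ⟨c, hγc, hβc⟩ :=
    exists_append_of_append_eq hγ (fun v hv => box_mono hh (β'.subset v hv)) heq
  rcases c with _ | ⟨v, c⟩
  · rw [List.append_nil] at hγc
    rw [List.nil_append] at hβc
    have hhead := head?_eq (le_trans h1 hh) β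
    rw [hβc, head?_eq h1 β', Option.some_inj] at hhead
    obtain ⟨hr, hp⟩ := bv_inj hhead
    exact ⟨by omega, by omega, hγc.symm, hβc⟩
  · exfalso
    have hvb : v ∈ box m p h W := β.subset v (by rw [hβc]; simp)
    have hvb' : v ∉ box m p h' W := hγ' v (by rw [hγc]; simp)
    rw [mem_box] at hvb hvb'
    refine hns h' hth (by omega) ⟨v :: c, β'.verts, hβc, fun u hu => ?_, fun u hu => ?_⟩
    · have hub : u ∈ box m p h W := β.subset u (by rw [hβc]; exact List.mem_append_left _ hu)
      have hub' : u ∉ box m p h' W := hγ' u (by rw [hγc]; exact List.mem_append_right _ hu)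
      rw [mem_box] at hub hub'
      omega
    · have hub := β'.subset u hu
      rw [mem_box] at hub
      omega

end RenewalCut

/-- **Stub 1 — the renewal cut.** `Σ_{h=t}^{2t} Σ_{j=-W}^{W} Z_{Λ∖box_h}(a → top_{h,j}) · κ_t(h,j) ≤ Z_Λ(a → door)`
for `Rect m (m+2t) (p-W) (p+W) ⊆ Λ`, `bv (m-1) p ∉ Λ`, `t ≥ 1`. [folklore] -/
theorem stub_renewalCut :
    ∀ (Λ : Finset HexVertex) (a : Sym2 HexVertex) (m p : ℤ) (t W : ℕ), 1 ≤ t →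
      Rect m (m + 2 * t) (p - W) (p + W) ⊆ Λ → bv (m - 1) p ∉ Λ →
      cutSum Λ a m p t W ≤ Z Λ a (door m p) := by
  intro Λ a m p t W ht hRect hout
  classical
  have hx : (0 : ℝ) ≤ hexCriticalFugacity := hexCriticalFugacity_pos_lt_one.1.le
  -- each term of the cut sum is the sum of `x_c^{|γ ++ β|}` over the pairs `(γ, β)` with `NoSplit`
  have hterm : ∀ (h : ℕ) (j : ℤ), Z (Λ \ box m p h W) a (top m p h j) * kernel m p t W h j =
      ∑ q ∈ (Finset.univ : Finset (HexMidEdgeSAW (Λ \ box m p h W) a (top m p h j) ×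
          HexMidEdgeSAW (box m p h W) (top m p h j) (door m p))).filter
            (fun q => NoSplit m t h q.2.verts),
        hexCriticalFugacity ^ (q.1.verts ++ q.2.verts).length := by
    intro h j
    rw [Z, norm_Z_eq_sum _ _ _ hx, kernel, Finset.sum_mul_sum, Finset.sum_filter,
      Fintype.sum_prod_type]
    refine Finset.sum_congr rfl fun γ _ => Finset.sum_congr rfl fun β _ => ?_
    dsimp only
    split_ifs
    · rw [← pow_add, HexMidEdgeSAW.length, HexMidEdgeSAW.length, List.length_append]
    · exact mul_zero _
  calc cutSum Λ a m p t W
      = ∑ q ∈ Finset.Icc t (2 * t) ×ˢ Finset.Icc (-(W : ℤ)) W,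
          Z (Λ \ box m p q.1 W) a (top m p q.1 q.2) * kernel m p t W q.1 q.2 := by
        rw [cutSum, Finset.sum_product]
    _ = ∑ i ∈ (Finset.Icc t (2 * t) ×ˢ Finset.Icc (-(W : ℤ)) W).sigma (fun q =>
          (Finset.univ : Finset (HexMidEdgeSAW (Λ \ box m p q.1 W) a (top m p q.1 q.2) ×
            HexMidEdgeSAW (box m p q.1 W) (top m p q.1 q.2) (door m p))).filter
              (fun γβ => NoSplit m t q.1 γβ.2.verts)),
          hexCriticalFugacity ^ (i.2.1.verts ++ i.2.2.verts).length := by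
        rw [Finset.sum_sigma]
        exact Finset.sum_congr rfl fun q _ => hterm q.1 q.2
    _ ≤ ∑ l ∈ (Finset.univ : Finset (HexMidEdgeSAW Λ a (door m p))).image HexMidEdgeSAW.verts,
          hexCriticalFugacity ^ l.length := by
        refine HV.sum_le_sum_of_injOn_of_nonneg
          (fun i : (Σ q : ℕ × ℤ, HexMidEdgeSAW (Λ \ box m p q.1 W) a (top m p q.1 q.2) ×
            HexMidEdgeSAW (box m p q.1 W) (top m p q.1 q.2) (door m p)) =>
              i.2.1.verts ++ i.2.2.verts) ?_ ?_
          (fun l : List HexVertex => hexCriticalFugacity ^ l.length) (fun _ _ => pow_nonneg hx _)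
        · -- injectivity: `RenewalCut.glue_inj`, applied with the larger of the two heights
          rintro ⟨⟨h, j⟩, γ, β⟩ hi ⟨⟨h', j'⟩, γ', β'⟩ hi' heq
          simp only [Finset.coe_sigma, Set.mem_sigma_iff, Finset.mem_coe, Finset.mem_product,
            Finset.mem_Icc, Finset.mem_filter, Finset.mem_univ, true_and] at hi hi'
          dsimp only at heq
          have hγo : ∀ v ∈ γ.verts, v ∉ box m p h W := fun v hv =>
            (Finset.mem_sdiff.1 (γ.subset v hv)).2
          have hγo' : ∀ v ∈ γ'.verts, v ∉ box m p h' W := fun v hv =>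
            (Finset.mem_sdiff.1 (γ'.subset v hv)).2
          obtain ⟨hhh, hjj, hγγ, hββ⟩ :
              h = h' ∧ j = j' ∧ γ.verts = γ'.verts ∧ β.verts = β'.verts := by
            rcases le_total h' h with hle | hle
            · exact RenewalCut.glue_inj hi'.1.1.1 hle (le_trans ht hi'.1.1.1) β β' hi.2 hγo
                hγo' heq
            · obtain ⟨e1, e2, e3, e4⟩ := RenewalCut.glue_inj hi.1.1.1 hle (le_trans ht hi.1.1.1)
                β' β hi'.2 hγo' hγo heq.symm
              exact ⟨e1.symm, e2.symm, e3.symm, e4.symm⟩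
          subst hhh hjj
          obtain rfl : γ = γ' := HexMidEdgeSAW.ext hγγ
          obtain rfl : β = β' := HexMidEdgeSAW.ext hββ
          rfl
        · -- the glued list is a walk of `Λ` from `a` to the door: `RenewalCut.glue`
          rintro ⟨⟨h, j⟩, γ, β⟩ hi
          simp only [Finset.mem_sigma, Finset.mem_product, Finset.mem_Icc, Finset.mem_filter,
            Finset.mem_univ, true_and] at hi
          obtain ⟨ω, hω⟩ := RenewalCut.glue (le_trans ht hi.1.1.1) hi.1.2
            ((RenewalCut.box_subset_Rect hi.1.1.2).trans hRect) hout γ β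
          exact Finset.mem_image.2 ⟨ω, Finset.mem_univ _, hω⟩
    _ = Z Λ a (door m p) := by
        rw [Finset.sum_image, Z, norm_Z_eq_sum _ _ _ hx]
        · rfl
        · exact fun γ _ γ' _ hγ => HexMidEdgeSAW.ext hγ

end Summit.CriticalPhenomena.SAWScalingLimit.Theorems.MassRatio.Renewal
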